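import Summits.QuantumFields.YangMills.Theorems.UnitScaleTiltProp7SectET3DeltaOneT3JTerm
import Summits.QuantumFields.YangMills.Theorems.UnitScaleTiltProp7SectET3DeltaOneT3SlotRealityRows
import Summits.QuantumFields.YangMills.Theorems.UnitScaleTiltProp7QTwSHessianReality
import HarnessLib

/-!
# Route `UnitScaleTilt`, crux «MinimiserStabilityRegPr» (stmt-QuantumFields-19200, stub EX) ∕ (O″χ) B0 (stmt-QuantumFields-20520), node N06(d = 3), route (α) —
# LAYER 0, ROWS OF BRICK L0b PART 4 (def-free): **THE THREE REALITY ROWS OF THE J-TERM OF RECORD `T_J(U₀)` ([Balaban1985BackgroundPropagators] (3.127)) — σ-ROW, TRACELESS SECTOR,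
# SYMMETRY — AT `U₀ ∈ 𝔘_k(ε₀)`, MODULO ONE DISPLAYED ROW** (`hAvgC`: the quadratic term `C⁽²⁾(U₀)` of the averaging has no centre coupling), **HENCE THE EX KNIT'S `hH₁R` CLAUSE AT PRINT'S
# `Δ₁` OF RECORD** (`DeltaOneJ = DeltaOne … TJSlot`, ✓`…DeltaOneT3JTerm`) modulo that single row

Cell `ym-inputs` (desk `pub/ym-inputs`, INPUT-LIST.md v10 §4 row p01; desk WORD 3 (b)∕4 (b) «rows later announce-first»; ★w4-20520 g4 CONSUMER LINE 2026-08-28T11:53:15Z).  THEOREMS ONLY (0 `def`,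
0 `sorry`); `--supports stmt-QuantumFields-20520 --as helper`; count-neutral.  YM₃ on T³ is ladder rung R3, NOT the Clay problem; nothing here is a claim about a stub, a crux, d = 4 or the mass gap.

THE MATHEMATICS.  `t_J[X, Y] = −⟨H(2C⁽²⁾[X, Y]), J⟩` (✓`tjForm_apply`).  (§1) The linear term is real: `⟨Zᴴ, J⟩ = −conj⟨Z, J⟩` — the first derivative of ✓`actionRe_chartU_neg_star`
(`𝒜(e^{−Zᴴ}U₀) = conj 𝒜(e^{Z}U₀)`) along the real-linear `Z ↦ −Zᴴ`.  (§2) If `C⁽²⁾` is symmetric (`hAs`), real on the traceless sector (`hAr`: `C⁽²⁾[X₀ᴴ, Y₀ᴴ] = −(C⁽²⁾[X₀, Y₀])ᴴ`) and flat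
on the centre (`hAc`: `C⁽²⁾[X, z·1] = 0`), then `t_J` is symmetric, flat on the centre in both slots, and REAL: splitting `X = X₀ + x·1`, `Y = Y₀ + y·1` kills the centre, and on the traceless parts
`t_J[X₀ᴴ, Y₀ᴴ] = −⟨H(−(2C⁽²⁾[X₀, Y₀])ᴴ), J⟩ = ⟨(H 2C⁽²⁾[X₀, Y₀])ᴴ, J⟩ = −conj⟨H 2C⁽²⁾[X₀, Y₀], J⟩ = conj t_J[X₀, Y₀]` by ★w4's ✓`H46_star_comm` (rows: ★w5's `QTwS` star row, p01's
✓`DeltaEta_toL2_star`).  (§3) Read on `L²` exactly as `Δ^η` (same `κ`, same real structure in the first slot): `T_J` is symmetric, commutes with `σ = toL2∘star∘toL2⁻¹`, and maps EVERY field to a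
traceless field (pair with `δ_b·1`).  (§4) At `U₀ ∈ 𝔘_k(ε₀)` in the windows `10⁹L²e ≤ 1`, `10¹²L³ε₀ ≤ 1`: `hQ` is ★w5's ✓`QTwS_star_comm_of_regPr`, `hAs`∕`hAr` are ✓`Prop7QTwSHessianReality`
(Schwarz + (Q-a)⁽²⁾), so the three rows of `T_J` hold modulo `hAvgC` alone, and ✓`H1f_isHermitian_traceless_at_regPr_DeltaOne` at `TJ := TJSlot` gives `hH₁R` at `Δ₁` of record modulo `hAvgC`.

WHAT IS PROVED: §1 ★`actionGrad_star`; §2 `tjForm_symm`, `tjForm_apply_smul_one`, `tjForm_smul_one_apply`, ★★`tjForm_star`, `tjSesq_conj_symm`; §3 ★★★`TJ_isSymmetric_of_rows`, ★★★`TJ_toL2_star_of_rows`,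
★★★`trace_TJ_toL2_eq_zero_of_rows` (all fields ↦ traceless); §4 ★★★`TJ_rows_of_regPr (hreg) (hAvgC)` (σ-row ∧ traceless row ∧ `IsSymmetric`), ★★★`H1f_isHermitian_traceless_at_regPr_DeltaOneJ (hreg) (hAvgC)`.
THE ONE DISPLAYED ROW `hAvgC : ∀ X z, avgHess F n K h U₀ X (fun b => z b • 1) = 0` = CENTRE-FLATNESS OF `C⁽²⁾(U₀)`: the second-order twin of ★w5-20520's (Q-b) ✓`QTwS_apply_smul_one_of_regPr`; it
follows from the centre-equivariance of the covariant averaging tower at a GENERAL perturbation `(ιφ)·e^{Y}U₀` (✓`Prop7SymAvgTwSym.dbarCovIterU_centralMul_self` is the case `Y = 0`; `holT_centralMul`,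
`emlAvgU_centralMul` are already general) — LOCATED on `pub/ym3-torus/STATUS.md` 2026-08-28T12:05:39Z for the ★w5 lineage; not proved here.
HONEST SCOPE.  Calculus ∕ star-algebra bookkeeping over landed letters; no estimate; nothing of print asserted; N06 NOT discharged; no stub closed.

References: T. Bałaban, CMP **99** (1985) 389–434 [Balaban1985BackgroundPropagators] ((3.7) p.391, (3.11)–(3.14) pp.392–393, (3.126)–(3.129) pp.420–421); CMP **102** (1985) 277–309
[Balaban1985Variational] ((51) p.286, (103) p.293, (110)–(111) p.294).
-/

set_option autoImplicit false

noncomputable section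

open scoped InnerProductSpace ComplexConjugate Matrix.Norms.L2Operator BigOperators

namespace Summit.QuantumFields.YangMills.Theorems.Prop7SectET3DeltaOne

open Literature.MathematicalPhysics.QuantumFieldTheory.Balaban1983to89
open Literature.MathematicalPhysics.QuantumFieldTheory.Balaban1983to89.T3ContinuumYM3Torus
open T3SectALandauChart (eta eta_pos)
open T3PrintedRegularMinimiser (RegPr)
open B9SectCLatticeCarrier (Bond)
open B9Eq311L2Pairing (WL2)
open B11Eq103H1Complex (SiteL2K BondL2K)
open B11Eq115Space (JetSup)
open Summit.QuantumFields.YangMills.Theorems.Prop7SectET3Transport (periodsT3 bondEquiv bgOfCfg)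
open Summit.QuantumFields.YangMills.Theorems.Prop7SectET3HilbertLetters (W₂ toL2 toL2B inner_toL2)
open Summit.QuantumFields.YangMills.Theorems.Prop7SectET3CurvedPropagators (H1f)
open Summit.QuantumFields.YangMills.Theorems.Prop7SectET3WilsonHessian (chartU actionRe DeltaEta contDiff_actionRe_chartU actionRe_chartU_neg_star DeltaEta_toL2_star inner_toL2_star_left)
open Summit.QuantumFields.YangMills.Theorems.Prop7SectET3DeltaPi (H46)
open Summit.QuantumFields.YangMills.Theorems.Prop7SymAvgTwSym (logChartTwS QTwS QTwS_star_comm_of_regPr)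
open Summit.QuantumFields.YangMills.Theorems.Prop7H46Reality (H46_star_comm)
open Summit.QuantumFields.YangMills.Theorems.Prop7QTwSHessianReality (fderiv_fderiv_logChartTwS_symm_of_regPr fderiv_fderiv_logChartTwS_star_of_traceless)

/-! ## §1 Reality of print's linear term `⟨·, J⟩`: `actionGrad (Zᴴ) = −conj (actionGrad Z)` -/

section GradReality

variable {F : T3Family} {K : ℕ}

/-- ★ **THE LINEAR TERM OF (3.7) IS REAL: `actionGrad U₀ (Zᴴ) = −conj (actionGrad U₀ Z)`** — first derivative at `0` of ✓`actionRe_chartU_neg_star` (`𝒜(e^{−Zᴴ}U₀) = conj 𝒜(e^{Z}U₀)`) along the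
real-linear involution `Z ↦ −Zᴴ`. [cite: Balaban1985BackgroundPropagators, (3.7) p.391, (3.11)–(3.12) p.392] -/
theorem actionGrad_star (U₀ : GaugeField (F.P K) 0 (Matrix.specialUnitaryGroup (Fin 2) ℂ)) (Z : PBond (F.P K) 0 → Matrix (Fin 2) (Fin 2) ℂ) :
    actionGrad F K U₀ (star Z) = -conj (actionGrad F K U₀ Z) := by
  set f : (PBond (F.P K) 0 → Matrix (Fin 2) (Fin 2) ℂ) → ℂ := fun X => actionRe F K (chartU F K U₀ X) with hf_def
  have hf : ContDiff ℂ ⊤ f := contDiff_actionRe_chartU U₀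
  let σ : (PBond (F.P K) 0 → Matrix (Fin 2) (Fin 2) ℂ) →L[ℝ] (PBond (F.P K) 0 → Matrix (Fin 2) (Fin 2) ℂ) :=
    -((starL' ℝ : (PBond (F.P K) 0 → Matrix (Fin 2) (Fin 2) ℂ) ≃L[ℝ] (PBond (F.P K) 0 → Matrix (Fin 2) (Fin 2) ℂ)) :
      (PBond (F.P K) 0 → Matrix (Fin 2) (Fin 2) ℂ) →L[ℝ] (PBond (F.P K) 0 → Matrix (Fin 2) (Fin 2) ℂ))
  have hσ : ∀ X : PBond (F.P K) 0 → Matrix (Fin 2) (Fin 2) ℂ, σ X = -star X := fun X => rfl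
  -- the functional identity `f ∘ σ = conj ∘ f`
  have hfun : (f ∘ (σ : (PBond (F.P K) 0 → Matrix (Fin 2) (Fin 2) ℂ) → (PBond (F.P K) 0 → Matrix (Fin 2) (Fin 2) ℂ))) =
      (Complex.conjCLE : ℂ → ℂ) ∘ f := by
    funext X
    simp only [Function.comp_apply, hσ, Complex.conjCLE_apply, hf_def]
    exact actionRe_chartU_neg_star U₀ X
  -- first real derivatives at `0`
  have h1 : HasFDerivAt f ((actionGrad F K U₀).restrictScalars ℝ) 0 := by
    have h := (hf.differentiable (by simp) 0).hasFDerivAt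
    rw [← actionGrad_def] at h
    exact h.restrictScalars ℝ
  have h1σ : HasFDerivAt f ((actionGrad F K U₀).restrictScalars ℝ) (σ 0) := by rw [map_zero]; exact h1
  have hL : HasFDerivAt (f ∘ (σ : (PBond (F.P K) 0 → Matrix (Fin 2) (Fin 2) ℂ) → (PBond (F.P K) 0 → Matrix (Fin 2) (Fin 2) ℂ)))
      (((actionGrad F K U₀).restrictScalars ℝ).comp σ) 0 := h1σ.comp 0 σ.hasFDerivAt
  have hR : HasFDerivAt ((Complex.conjCLE : ℂ → ℂ) ∘ f) ((Complex.conjCLE : ℂ →L[ℝ] ℂ).comp ((actionGrad F K U₀).restrictScalars ℝ)) 0 :=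
    (Complex.conjCLE : ℂ →L[ℝ] ℂ).hasFDerivAt.comp 0 h1
  rw [hfun] at hL
  have heq := hR.unique hL
  have key := congrArg (fun T : (PBond (F.P K) 0 → Matrix (Fin 2) (Fin 2) ℂ) →L[ℝ] ℂ => T Z) heq
  simp only [ContinuousLinearMap.comp_apply, ContinuousLinearMap.coe_restrictScalars', hσ, map_neg, ContinuousLinearEquiv.coe_coe, Complex.conjCLE_apply] at key
  -- `key : conj (actionGrad Z) = -(actionGrad (star Z))`
  rw [key, neg_neg]

end GradReality

/-! ## §2 The J-term form `t_J` is symmetric and real when `C⁽²⁾` is (symmetric, real on the traceless sector, flat on the centre) -/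

section FormRows

variable {F : T3Family} {n K : ℕ} {h : n ≤ K} {c₀ cB a : ℝ} [Fact (0 < c₀)] [Fact (0 < cB)]
variable (U₀ : GaugeField (F.P K) 0 (Matrix.specialUnitaryGroup (Fin 2) ℂ))
  (hQ : ∀ A : PBond (F.P K) 0 → Matrix (Fin 2) (Fin 2) ℂ, QTwS F n K h U₀ (star A) = star (QTwS F n K h U₀ A))
  (hAs : ∀ X Y : PBond (F.P K) 0 → Matrix (Fin 2) (Fin 2) ℂ, avgHess F n K h U₀ X Y = avgHess F n K h U₀ Y X)
  (hAr : ∀ X Y : PBond (F.P K) 0 → Matrix (Fin 2) (Fin 2) ℂ, (∀ b, (X b).trace = 0) → (∀ b, (Y b).trace = 0) →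
    ∀ c, avgHess F n K h U₀ (star X) (star Y) c = -star (avgHess F n K h U₀ X Y c))
  (hAc : ∀ (X : PBond (F.P K) 0 → Matrix (Fin 2) (Fin 2) ℂ) (z : PBond (F.P K) 0 → ℂ), avgHess F n K h U₀ X (fun b => z b • (1 : Matrix (Fin 2) (Fin 2) ℂ)) = 0)

include hAs in
/-- **`t_J` IS SYMMETRIC WHEN `C⁽²⁾` IS** (Schwarz). [cite: Balaban1985BackgroundPropagators, (3.127) p.421] -/
theorem tjForm_symm (X Y : PBond (F.P K) 0 → Matrix (Fin 2) (Fin 2) ℂ) : tjForm F n K h c₀ cB a U₀ X Y = tjForm F n K h c₀ cB a U₀ Y X := by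
  rw [tjForm_apply, tjForm_apply, hAs]

include hAc in
/-- **`t_J` VANISHES ON CENTRAL DIRECTIONS IN THE SECOND SLOT WHEN `C⁽²⁾` DOES.** [cite: Balaban1985BackgroundPropagators, (3.127) p.421] -/
theorem tjForm_apply_smul_one (X : PBond (F.P K) 0 → Matrix (Fin 2) (Fin 2) ℂ) (z : PBond (F.P K) 0 → ℂ) :
    tjForm F n K h c₀ cB a U₀ X (fun b => z b • (1 : Matrix (Fin 2) (Fin 2) ℂ)) = 0 := by
  rw [tjForm_apply, hAc, map_zero, map_zero, neg_zero]

include hAs hAc in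
/-- … and in the first slot (symmetry). [cite: Balaban1985BackgroundPropagators, (3.127) p.421] -/
theorem tjForm_smul_one_apply (z : PBond (F.P K) 0 → ℂ) (X : PBond (F.P K) 0 → Matrix (Fin 2) (Fin 2) ℂ) :
    tjForm F n K h c₀ cB a U₀ (fun b => z b • (1 : Matrix (Fin 2) (Fin 2) ℂ)) X = 0 := by
  rw [tjForm_symm U₀ hAs]; exact tjForm_apply_smul_one U₀ hAc X z

include hQ hAs hAr hAc in
/-- ★★ **`t_J` IS REAL: `t_J[Xᴴ, Yᴴ] = conj t_J[X, Y]` FOR ALL `X, Y`** — split off the centre (`t_J` is flat there), and on the traceless parts use `C⁽²⁾[X₀ᴴ, Y₀ᴴ] = −(C⁽²⁾[X₀, Y₀])ᴴ`,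
`H(Mᴴ) = (HM)ᴴ` (★w4 ✓`H46_star_comm`, rows `hQ` + p01 ✓`DeltaEta_toL2_star`) and `⟨Zᴴ, J⟩ = −conj⟨Z, J⟩` (§1). [cite: Balaban1985BackgroundPropagators, (3.127) p.421; Balaban1985Variational, (51) p.286] -/
theorem tjForm_star (X Y : PBond (F.P K) 0 → Matrix (Fin 2) (Fin 2) ℂ) :
    tjForm F n K h c₀ cB a U₀ (star X) (star Y) = conj (tjForm F n K h c₀ cB a U₀ X Y) := by
  -- centre ∕ traceless splitting of both arguments
  set x : PBond (F.P K) 0 → ℂ := fun b => (2 : ℂ)⁻¹ * (X b).trace with hx_def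
  set y : PBond (F.P K) 0 → ℂ := fun b => (2 : ℂ)⁻¹ * (Y b).trace with hy_def
  set X₀ : PBond (F.P K) 0 → Matrix (Fin 2) (Fin 2) ℂ := X - fun b => x b • (1 : Matrix (Fin 2) (Fin 2) ℂ) with hX₀_def
  set Y₀ : PBond (F.P K) 0 → Matrix (Fin 2) (Fin 2) ℂ := Y - fun b => y b • (1 : Matrix (Fin 2) (Fin 2) ℂ) with hY₀_def
  have htr1 : Matrix.trace (1 : Matrix (Fin 2) (Fin 2) ℂ) = 2 := by rw [Matrix.trace_one, Fintype.card_fin]; norm_num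
  have hX₀ : ∀ b, (X₀ b).trace = 0 := fun b => by rw [hX₀_def, Pi.sub_apply, Matrix.trace_sub, Matrix.trace_smul, htr1, smul_eq_mul, hx_def]; ring
  have hY₀ : ∀ b, (Y₀ b).trace = 0 := fun b => by rw [hY₀_def, Pi.sub_apply, Matrix.trace_sub, Matrix.trace_smul, htr1, smul_eq_mul, hy_def]; ring
  have hXd : X = X₀ + fun b => x b • (1 : Matrix (Fin 2) (Fin 2) ℂ) := by rw [hX₀_def, sub_add_cancel]
  have hYd : Y = Y₀ + fun b => y b • (1 : Matrix (Fin 2) (Fin 2) ℂ) := by rw [hY₀_def, sub_add_cancel]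
  have hstar_c : ∀ z : PBond (F.P K) 0 → ℂ, star (fun b => z b • (1 : Matrix (Fin 2) (Fin 2) ℂ)) = fun b => (starRingEnd ℂ (z b)) • (1 : Matrix (Fin 2) (Fin 2) ℂ) :=
    fun z => funext fun b => by rw [Pi.star_apply, star_smul, Matrix.star_eq_conjTranspose, Matrix.conjTranspose_one, Complex.star_def]
  have hXs : star X = star X₀ + fun b => (starRingEnd ℂ (x b)) • (1 : Matrix (Fin 2) (Fin 2) ℂ) := by rw [hXd, star_add, hstar_c]
  have hYs : star Y = star Y₀ + fun b => (starRingEnd ℂ (y b)) • (1 : Matrix (Fin 2) (Fin 2) ℂ) := by rw [hYd, star_add, hstar_c]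
  -- `t_J` only sees the traceless parts
  have red : tjForm F n K h c₀ cB a U₀ X Y = tjForm F n K h c₀ cB a U₀ X₀ Y₀ := by
    conv_lhs => rw [hXd, hYd]
    simp only [map_add, add_apply, tjForm_apply_smul_one U₀ hAc, tjForm_smul_one_apply U₀ hAs hAc, add_zero]
  have reds : tjForm F n K h c₀ cB a U₀ (star X) (star Y) = tjForm F n K h c₀ cB a U₀ (star X₀) (star Y₀) := by
    rw [hXs, hYs]
    simp only [map_add, add_apply, tjForm_apply_smul_one U₀ hAc, tjForm_smul_one_apply U₀ hAs hAc, add_zero]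
  -- the traceless case
  have hΔη : ∀ f : BondL2K ℂ 3 (periodsT3 F K) c₀ W₂,
      DeltaEta F n K c₀ U₀ (toL2 F K c₀ (star ((toL2 F K c₀).symm f))) = toL2 F K c₀ (star ((toL2 F K c₀).symm (DeltaEta F n K c₀ U₀ f))) := fun f => by
    have key := DeltaEta_toL2_star (F := F) (n := n) (K := K) (c₀ := c₀) U₀ ((toL2 F K c₀).symm f)
    rwa [LinearEquiv.apply_symm_apply] at key
  have hM : avgHess F n K h U₀ (star X₀) (star Y₀) = -star (avgHess F n K h U₀ X₀ Y₀) := funext fun c => by rw [Pi.neg_apply, Pi.star_apply]; exact hAr X₀ Y₀ hX₀ hY₀ c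
  rw [red, reds, tjForm_apply, tjForm_apply, hM, map_neg, map_neg, neg_neg, H46_star_comm F n K h c₀ cB a U₀ hQ hΔη, actionGrad_star, map_neg]

include hQ hAs hAr hAc in
/-- ★★ **THE SESQUILINEAR FORM OF `T_J` IS CONJUGATE-SYMMETRIC: `conj (tjSesq U₀ w v) = tjSesq U₀ v w`.** [cite: Balaban1985BackgroundPropagators, (3.127) p.421] -/
theorem tjSesq_conj_symm (v w : BondL2K ℂ 3 (periodsT3 F K) c₀ W₂) :
    conj (tjSesq F n K h c₀ cB a U₀ w v) = tjSesq F n K h c₀ cB a U₀ v w := by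
  have hc : conj ((-(2 * (c₀ : ℂ)) / (((eta F n K : ℝ) : ℂ)) ^ 2)) = (-(2 * (c₀ : ℂ)) / (((eta F n K : ℝ) : ℂ)) ^ 2) := by
    rw [map_div₀, map_neg, map_mul, map_pow, map_ofNat, Complex.conj_ofReal, Complex.conj_ofReal]
  rw [tjSesq_apply, tjSesq_apply, map_mul, hc, ← tjForm_star U₀ hQ hAs hAr hAc, star_star, tjForm_symm U₀ hAs]

/-! ## §3 The three rows of `T_J(U₀)` -/

include hQ hAs hAr hAc in
/-- ★★★ **`T_J(U₀)` IS SYMMETRIC** (the row `hTsymm`). [cite: Balaban1985BackgroundPropagators, (3.127)–(3.128) p.421] -/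
theorem TJ_isSymmetric_of_rows :
    ((TJ F n K h c₀ cB a U₀ : BondL2K ℂ 3 (periodsT3 F K) c₀ W₂ →L[ℂ] BondL2K ℂ 3 (periodsT3 F K) c₀ W₂) :
      BondL2K ℂ 3 (periodsT3 F K) c₀ W₂ →ₗ[ℂ] BondL2K ℂ 3 (periodsT3 F K) c₀ W₂).IsSymmetric := by
  intro v w
  show ⟪TJ F n K h c₀ cB a U₀ v, w⟫_ℂ = ⟪v, TJ F n K h c₀ cB a U₀ w⟫_ℂ
  rw [inner_TJ_left, ← inner_conj_symm, inner_TJ_left, tjSesq_conj_symm U₀ hQ hAs hAr hAc]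

include hQ hAs hAr hAc in
/-- ★★★ **`T_J(U₀)` COMMUTES WITH THE REAL STRUCTURE `σ = toL2 ∘ star ∘ toL2⁻¹`** (the row `hT`, binder shape of ✓`H1f_isHermitian_traceless_at_regPr`).
[cite: Balaban1985BackgroundPropagators, (3.127) p.421; Balaban1985Variational, (51) p.286] -/
theorem TJ_toL2_star_of_rows :
    ∀ f : BondL2K ℂ 3 (periodsT3 F K) c₀ W₂,
      TJ F n K h c₀ cB a U₀ (toL2 F K c₀ (star ((toL2 F K c₀).symm f))) = toL2 F K c₀ (star ((toL2 F K c₀).symm (TJ F n K h c₀ cB a U₀ f))) := by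
  intro f
  have hc : conj ((-(2 * (c₀ : ℂ)) / (((eta F n K : ℝ) : ℂ)) ^ 2)) = (-(2 * (c₀ : ℂ)) / (((eta F n K : ℝ) : ℂ)) ^ 2) := by
    rw [map_div₀, map_neg, map_mul, map_pow, map_ofNat, Complex.conj_ofReal, Complex.conj_ofReal]
  obtain ⟨X, rfl⟩ : ∃ X, toL2 F K c₀ X = f := ⟨(toL2 F K c₀).symm f, (toL2 F K c₀).apply_symm_apply f⟩
  rw [LinearEquiv.symm_apply_apply]
  refine ext_inner_right ℂ fun w => ?_
  obtain ⟨Y, rfl⟩ : ∃ Y, toL2 F K c₀ Y = w := ⟨(toL2 F K c₀).symm w, (toL2 F K c₀).apply_symm_apply w⟩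
  rw [inner_TJ_left, tjSesq_apply, LinearEquiv.symm_apply_apply, LinearEquiv.symm_apply_apply, star_star, inner_toL2_star_left, LinearEquiv.apply_symm_apply,
    inner_TJ_left, tjSesq_apply, LinearEquiv.symm_apply_apply, LinearEquiv.symm_apply_apply, map_mul, hc, ← tjForm_star U₀ hQ hAs hAr hAc, star_star, star_star]

open Classical in
include hAc in
/-- ★★★ **`T_J(U₀)` MAPS EVERY FIELD TO A TRACELESS FIELD** (in particular the row `hTtr`): pair with `δ_b·1`, `⟪T_J(toL2 A), toL2(δ_b·1)⟫ = κ·t_J[Aᴴ, δ_b·1] = 0` since `t_J` is flat on the centre.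
[cite: Balaban1985BackgroundPropagators, (3.127) p.421; Balaban1985Variational, (51) p.286] -/
theorem trace_TJ_toL2_eq_zero_of_rows (A : PBond (F.P K) 0 → Matrix (Fin 2) (Fin 2) ℂ) (b : PBond (F.P K) 0) :
    ((toL2 F K c₀).symm (TJ F n K h c₀ cB a U₀ (toL2 F K c₀ A)) b).trace = 0 := by
  set Z : PBond (F.P K) 0 → Matrix (Fin 2) (Fin 2) ℂ := (toL2 F K c₀).symm (TJ F n K h c₀ cB a U₀ (toL2 F K c₀ A)) with hZ_def
  have hE : (Pi.single b (1 : Matrix (Fin 2) (Fin 2) ℂ) : PBond (F.P K) 0 → Matrix (Fin 2) (Fin 2) ℂ) =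
      fun b' => (Pi.single b (1 : ℂ) : PBond (F.P K) 0 → ℂ) b' • (1 : Matrix (Fin 2) (Fin 2) ℂ) := by
    funext b'
    by_cases hb : b' = b
    · subst hb; rw [Pi.single_eq_same, Pi.single_eq_same, one_smul]
    · rw [Pi.single_eq_of_ne hb, Pi.single_eq_of_ne hb, zero_smul]
  have key : ⟪TJ F n K h c₀ cB a U₀ (toL2 F K c₀ A), toL2 F K c₀ (Pi.single b (1 : Matrix (Fin 2) (Fin 2) ℂ))⟫_ℂ = 0 := by
    rw [inner_TJ_left, tjSesq_apply, LinearEquiv.symm_apply_apply, LinearEquiv.symm_apply_apply, hE, tjForm_apply_smul_one U₀ hAc, mul_zero]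
  have h2 : ⟪toL2 F K c₀ (Pi.single b (1 : Matrix (Fin 2) (Fin 2) ℂ)), toL2 F K c₀ Z⟫_ℂ = (c₀ : ℂ) * (Z b).trace := by
    rw [inner_toL2, Finset.sum_eq_single b (fun b' _ hb' => by rw [Pi.single_eq_of_ne hb', Matrix.conjTranspose_zero, Matrix.zero_mul, Matrix.trace_zero])
      (fun hb => (hb (Finset.mem_univ b)).elim), Pi.single_eq_same, Matrix.conjTranspose_one, Matrix.one_mul]
  have h3 : ⟪toL2 F K c₀ (Pi.single b (1 : Matrix (Fin 2) (Fin 2) ℂ)), toL2 F K c₀ Z⟫_ℂ = 0 := by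
    rw [hZ_def, LinearEquiv.apply_symm_apply, ← inner_conj_symm, key, map_zero]
  have hc₀ : (c₀ : ℂ) ≠ 0 := Complex.ofReal_ne_zero.2 (Fact.out : 0 < c₀).ne'
  rw [h3] at h2
  exact (mul_eq_zero.1 h2.symm).resolve_left hc₀

end FormRows

/-! ## §4 At `U₀ ∈ 𝔘_k(ε₀)`: the rows of the J-term of record modulo the single centre row, and `hH₁R` at `Δ₁` of record -/

section Record

variable (F : T3Family) {n K : ℕ} (h : n ≤ K) (c₀ cB a : ℝ) [Fact (0 < c₀)] [Fact (0 < cB)]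

/-- ★★★ **THE THREE ROWS OF `T_J(U₀)` AT `U₀ ∈ 𝔘_k(ε₀)` MODULO THE CENTRE ROW `hAvgC`** (in the windows `10⁹L²e ≤ 1`, `10¹²L³ε₀ ≤ 1`): σ-row, traceless row, symmetry — `QTwS`'s star row is
★w5's ✓`QTwS_star_comm_of_regPr`, `C⁽²⁾`'s symmetry and traceless-sector reality are ✓`Prop7QTwSHessianReality`; displayed: `hAvgC` (centre-flatness of `C⁽²⁾(U₀)`, the second-order twin of (Q-b)).
[cite: Balaban1985BackgroundPropagators, (3.127)–(3.128) p.421, (3.14) p.393; Balaban1985Variational, (51) p.286] -/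
theorem TJ_rows_of_regPr [Fact (0 < (F.L : ℝ))] [Fact (0 < ((F.L : ℝ)⁻¹) ^ (K - n))]
    {ε₀ e : ℝ} (hε₀ : 0 < ε₀) (he : 0 < e) (hWe : 10 ^ 9 * (F.L : ℝ) ^ 2 * e ≤ 1) (hWε : 10 ^ 12 * (F.L : ℝ) ^ 3 * ε₀ ≤ 1)
    (U₀ : GaugeField (F.P K) 0 (Matrix.specialUnitaryGroup (Fin 2) ℂ)) (hreg : RegPr F n K ε₀ U₀)
    (hAvgC : ∀ (X : PBond (F.P K) 0 → Matrix (Fin 2) (Fin 2) ℂ) (z : PBond (F.P K) 0 → ℂ), avgHess F n K h U₀ X (fun b => z b • (1 : Matrix (Fin 2) (Fin 2) ℂ)) = 0) :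
    (∀ f : BondL2K ℂ 3 (periodsT3 F K) c₀ W₂,
        TJ F n K h c₀ cB a U₀ (toL2 F K c₀ (star ((toL2 F K c₀).symm f))) = toL2 F K c₀ (star ((toL2 F K c₀).symm (TJ F n K h c₀ cB a U₀ f)))) ∧
      (∀ A : PBond (F.P K) 0 → Matrix (Fin 2) (Fin 2) ℂ, (∀ b, (A b).trace = 0) → ∀ b, ((toL2 F K c₀).symm (TJ F n K h c₀ cB a U₀ (toL2 F K c₀ A)) b).trace = 0) ∧
      ((TJ F n K h c₀ cB a U₀ : BondL2K ℂ 3 (periodsT3 F K) c₀ W₂ →L[ℂ] BondL2K ℂ 3 (periodsT3 F K) c₀ W₂) :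
        BondL2K ℂ 3 (periodsT3 F K) c₀ W₂ →ₗ[ℂ] BondL2K ℂ 3 (periodsT3 F K) c₀ W₂).IsSymmetric := by
  have hQ := QTwS_star_comm_of_regPr F h hε₀ he hWe hWε U₀ hreg
  have hAs : ∀ X Y : PBond (F.P K) 0 → Matrix (Fin 2) (Fin 2) ℂ, avgHess F n K h U₀ X Y = avgHess F n K h U₀ Y X := fun X Y => by
    rw [avgHess_def]; exact fderiv_fderiv_logChartTwS_symm_of_regPr F h hε₀ he hWe hWε U₀ hreg X Y
  have hAr : ∀ X Y : PBond (F.P K) 0 → Matrix (Fin 2) (Fin 2) ℂ, (∀ b, (X b).trace = 0) → (∀ b, (Y b).trace = 0) →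
      ∀ c, avgHess F n K h U₀ (star X) (star Y) c = -star (avgHess F n K h U₀ X Y c) := fun X Y hX hY c => by
    rw [avgHess_def]; exact fderiv_fderiv_logChartTwS_star_of_traceless F h hε₀ he hWe hWε U₀ hreg X Y hX hY c
  exact ⟨TJ_toL2_star_of_rows U₀ hQ hAs hAr hAvgC, fun A _ b => trace_TJ_toL2_eq_zero_of_rows U₀ hAvgC A b, TJ_isSymmetric_of_rows U₀ hQ hAs hAr hAvgC⟩

/-- ★★★ **THE KNIT'S `hH₁R` CLAUSE AT `Δ₁` OF RECORD (`DeltaOneJ = DeltaOne … TJSlot`), MODULO THE SINGLE DISPLAYED ROW `hAvgC`**: at `U₀ ∈ 𝔘_k(ε₀)` in the windows, Hermitian traceless block data give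
Hermitian traceless `(H₁f … (DeltaOne … TJSlot) U₀ B)(x)` — ✓`H1f_isHermitian_traceless_at_regPr_DeltaOne` at `TJ := TJSlot` with the three rows of `TJ_rows_of_regPr`.
[cite: Balaban1985Variational, (103) p.293, (110) p.294, (51) p.286; Balaban1985BackgroundPropagators, (3.127)–(3.129) p.421] -/
theorem H1f_isHermitian_traceless_at_regPr_DeltaOneJ [Fact (0 < (F.L : ℝ))] [Fact (0 < ((F.L : ℝ)⁻¹) ^ (K - n))]
    {ε₀ e : ℝ} (hε₀ : 0 < ε₀) (he : 0 < e) (hWe : 10 ^ 9 * (F.L : ℝ) ^ 2 * e ≤ 1) (hWε : 10 ^ 12 * (F.L : ℝ) ^ 3 * ε₀ ≤ 1)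
    (U₀ : GaugeField (F.P K) 0 (Matrix.specialUnitaryGroup (Fin 2) ℂ)) (hreg : RegPr F n K ε₀ U₀)
    (hAvgC : ∀ (X : PBond (F.P K) 0 → Matrix (Fin 2) (Fin 2) ℂ) (z : PBond (F.P K) 0 → ℂ), avgHess F n K h U₀ X (fun b => z b • (1 : Matrix (Fin 2) (Fin 2) ℂ)) = 0) :
    ∀ B : PBond (F.P n) 0 → Matrix (Fin 2) (Fin 2) ℂ, (∀ c, (B c).IsHermitian ∧ (B c).trace = 0) →
      ∀ x : Bond 3 (periodsT3 F K), (JetSup.equiv _ _ _ (H1f F n K h c₀ cB a (DeltaOne F n K h c₀ cB a (TJSlot F n K h c₀ cB a)) U₀ B) x).IsHermitian ∧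
        (JetSup.equiv _ _ _ (H1f F n K h c₀ cB a (DeltaOne F n K h c₀ cB a (TJSlot F n K h c₀ cB a)) U₀ B) x).trace = 0 := by
  obtain ⟨hT, hTtr, hTsymm⟩ := TJ_rows_of_regPr F h c₀ cB a hε₀ he hWe hWε U₀ hreg hAvgC
  exact H1f_isHermitian_traceless_at_regPr_DeltaOne F n K h c₀ cB a (TJSlot F n K h c₀ cB a) U₀ hε₀ he hWe hWε hreg hT hTtr hTsymm

end Record

end Summit.QuantumFields.YangMills.Theorems.Prop7SectET3DeltaOne

end
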